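import Summits.CriticalPhenomena.PercolationContinuityZ3.Theorems.PercNearOneGluingNoHeavyLowerTailSahiOneStepCone
import HarnessLib

/-!
# One-step scheme, `(2′)` half: the TRANSITION-COUPLING CRITERION

Support file (prover prim-ineq-prove-3 gen 43; `--supports stmt-CriticalPhenomena-4575`; memo
`run/shared/lean/prim/prim-ineq-prove-3/FINDING-G43-TRANSITION-COUPLING.md` §1).  No definitions, no named facts, no sorries.

The `(2′)` inequality `0 ≤ n(H; A, B)` (`osN`; on up-set indicators it reads `Cov(A,B) ≥ μ(Hᶜ)·Cov(A,B ∣ Hᶜ)`) is equivalent to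
`Cov(1_B, 1_{A∩H}) ≥ μ(A ∣ Hᶜ)·Cov(1_B, 1_H)`.  This file proves a COUPLING CRITERION for it: let `π` be any sub-Markov transport
plan from the product weight `μ` to the conditioned weight `μ(· ∣ B)` which only moves points upwards (`π x y ≠ 0 → x ⊆ y`), and let
`τ(y) = Σ_{x ∉ H} π x y` (`y ∈ H`) be its TRANSITION measure (mass crossing from `Hᶜ` into `H`).  If the single inequality
`μ(A ∩ Hᶜ)·τ(H) ≤ μ(Hᶜ)·τ(A ∩ H)` holds — i.e. the normalised transition measure gives the up-set `A` at least the mass `μ(A ∣ Hᶜ)` —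
then `0 ≤ n(H; A, B)`, for `H` and `A` up-sets and `B` arbitrary (`osN_ind_ind_nonneg_of_transitionCoupling`).
Proof: `μ(A∩H ∣ B) ≥ μ(A∩H) + τ(A∩H)` (mass of `A∩H` stays in `A∩H`, and `τ(A∩H)` arrives from `Hᶜ`), `τ(H) = μ(Hᶜ) − μ(Hᶜ ∣ B)`
(a point of `Hᶜ` can only come from `Hᶜ`), and the algebra `n = μ(Hᶜ)[μ(ABH) − μ(B)μ(AH)] − μ(AHᶜ)·Cov(B,H)`.
In particular, if the normalised transition measure of some monotone coupling of `μ` and `μ(· ∣ B)` stochastically dominates `μ(· ∣ Hᶜ)`,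
then `(2′)` holds for `B` against EVERY increasing `A` (criterion `(S2)` of the memo; census: feasible for every up-set `B ⊆ 2^[5]`).
-/

noncomputable section

namespace Summit.CriticalPhenomena.PercolationContinuityZ3.Theorems

namespace SahiOneStep

open Literature.Combinatorics.Sahi2008
open Literature.Probability.Percolation (DeterminedBy)
open Literature.Probability.Percolation.DecisionTree (ind ind_of_mem ind_of_not_mem ind_nonneg)
open Literature.Probability.Percolation.BHK2006 (weight weight_nonneg)
open Literature.Probability.LatticeModels (prodBernoulli)
open MeasureTheory

variable {ι : Type*} [Fintype ι] [DecidableEq ι]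

omit [DecidableEq ι] in
/-- `ind X x ≤ 1`. [folklore] -/
private theorem ind_le_one' {α : Type*} (X : Set α) (x : α) : ind X x ≤ 1 := by
  by_cases h : x ∈ X
  · rw [ind_of_mem h]
  · rw [ind_of_not_mem h]; exact zero_le_one

omit [DecidableEq ι] in
/-- The measure of an event as a weighted sum of its indicator (bridge to `prodBernoulli`). [folklore] -/
private theorem real_eq_sum (p : ι → unitInterval) (C : Set (Set ι)) :
    (prodBernoulli p).real C = ∑ ω, bernoulliWeight p ω * ind C ω :=
  Literature.Probability.Percolation.prodBernoulli_real_eq_sum_weight_ind p C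

omit [DecidableEq ι] in
/-- **TRANSITION-COUPLING CRITERION for `(2′)`.**  Let `H, A` be up-sets and `B` any event; let `π ≥ 0` be an upward transport plan
(`π x y ≠ 0 → x ⊆ y`) with row sums the product weight `μ` and column sums `μ(B)⁻¹·μ|_B` (stated multiplied out:
`μ(B)·Σ_x π x y = μ(y)·1_B(y)`), and `τ(y) := Σ_{x ∉ H} π x y` for `y ∈ H` its transition measure.  If
`μ(A ∩ Hᶜ)·τ(H) ≤ μ(Hᶜ)·τ(H ∩ A)`, then `0 ≤ n(H; 1_A, 1_B)`. [this work] -/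
theorem osN_ind_ind_nonneg_of_transitionCoupling (p : ι → unitInterval) {H A B : Set (Set ι)}
    (hH : IsUpperSet H) (hA : IsUpperSet A)
    (π : Set ι → Set ι → ℝ) (hπ0 : ∀ x y, 0 ≤ π x y) (hπle : ∀ x y, π x y ≠ 0 → x ⊆ y)
    (hrow : ∀ x, ∑ y, π x y = bernoulliWeight p x)
    (hcol : ∀ y, (prodBernoulli p).real B * ∑ x, π x y = bernoulliWeight p y * ind B y)
    (hτ : (prodBernoulli p).real (A ∩ Hᶜ) * ∑ x, ∑ y, ind Hᶜ x * ind H y * π x y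
        ≤ (prodBernoulli p).real Hᶜ * ∑ x, ∑ y, ind Hᶜ x * ind (H ∩ A) y * π x y) :
    0 ≤ osN p H (ind A) (ind B) := by
  classical
  set μ := prodBernoulli p with hμ
  set τH : ℝ := ∑ x, ∑ y, ind Hᶜ x * ind H y * π x y with hτH
  set τA : ℝ := ∑ x, ∑ y, ind Hᶜ x * ind (H ∩ A) y * π x y with hτA
  -- (E1): `μ(B) · Σ_x Σ_y 1_T(y) π x y = μ(T ∩ B)` for every event `T`.
  have E1 : ∀ T : Set (Set ι), μ.real B * ∑ x, ∑ y, ind T y * π x y = μ.real (T ∩ B) := by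
    intro T
    have hswap : (∑ x, ∑ y, ind T y * π x y) = ∑ y, ind T y * ∑ x, π x y := by
      rw [Finset.sum_comm]
      exact Finset.sum_congr rfl fun y _ => by rw [Finset.mul_sum]
    rw [hswap]
    rw [Finset.mul_sum Finset.univ (fun y => ind T y * ∑ x, π x y) (μ.real B)]
    rw [real_eq_sum p (T ∩ B)]
    refine Finset.sum_congr rfl fun y _ => ?_
    rw [mul_left_comm, hcol y, Literature.Probability.Percolation.BHK2006.ind_inter]
    ring
  -- (E2): `Σ_x 1_S(x) Σ_y π x y = μ(S)`.
  have E2 : ∀ S : Set (Set ι), ∑ x, ∑ y, ind S x * π x y = μ.real S := by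
    intro S
    rw [real_eq_sum]
    refine Finset.sum_congr rfl fun x _ => ?_
    rw [← Finset.mul_sum, hrow x, mul_comm]
  -- (E3): mass of `A ∩ H` stays inside `A ∩ H`.
  have E3 : ∑ x, ∑ y, ind (H ∩ A) x * (ind (H ∩ A) y * π x y) = μ.real (H ∩ A) := by
    rw [← E2 (H ∩ A)]
    refine Finset.sum_congr rfl fun x _ => Finset.sum_congr rfl fun y _ => ?_
    by_cases hx : x ∈ H ∩ A
    · by_cases hπ : π x y = 0
      · simp only [hπ, mul_zero]
      · have hy : y ∈ H ∩ A := ⟨hH (hπle x y hπ) hx.1, hA (hπle x y hπ) hx.2⟩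
        rw [ind_of_mem hy, one_mul]
    · simp only [ind_of_not_mem hx, zero_mul]
  -- (E4): a point of `Hᶜ` can only be reached from `Hᶜ`.
  have E4 : ∑ x, ∑ y, ind Hᶜ x * ind Hᶜ y * π x y = ∑ x, ∑ y, ind Hᶜ y * π x y := by
    refine Finset.sum_congr rfl fun x _ => Finset.sum_congr rfl fun y _ => ?_
    by_cases hy : y ∈ Hᶜ
    · by_cases hπ : π x y = 0
      · simp only [hπ, mul_zero]
      · have hx : x ∈ Hᶜ := fun hxH => hy (hH (hπle x y hπ) hxH)
        rw [ind_of_mem hx, one_mul]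
    · simp only [ind_of_not_mem hy, mul_zero, zero_mul]
  -- τ(H) = μ(Hᶜ) − (mass Hᶜ → Hᶜ), hence `μ(B)·τ(H) = μ(B)μ(Hᶜ) − μ(Hᶜ ∩ B)`.
  have hτH_eq : μ.real B * τH = μ.real B * μ.real Hᶜ - μ.real (Hᶜ ∩ B) := by
    have h1 : τH = ∑ x, ∑ y, ind Hᶜ x * π x y - ∑ x, ∑ y, ind Hᶜ x * ind Hᶜ y * π x y := by
      rw [hτH, ← Finset.sum_sub_distrib]
      refine Finset.sum_congr rfl fun x _ => ?_
      rw [← Finset.sum_sub_distrib]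
      refine Finset.sum_congr rfl fun y _ => ?_
      by_cases hy : y ∈ H
      · rw [ind_of_mem hy, ind_of_not_mem (fun h => (Set.mem_compl_iff H y).mp h hy)]; ring
      · rw [ind_of_not_mem hy, ind_of_mem (show y ∈ Hᶜ from hy)]; ring
    rw [h1, mul_sub, E2 Hᶜ, E4, E1 Hᶜ]
  -- `μ(H ∩ A ∩ B) ≥ μ(B)·(μ(H ∩ A) + τ(H ∩ A))`.
  have hτA_le : μ.real B * (μ.real (H ∩ A) + τA) ≤ μ.real (H ∩ A ∩ B) := by
    rw [← E1 (H ∩ A), ← E3, hτA]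
    have hB0 : 0 ≤ μ.real B := measureReal_nonneg
    refine mul_le_mul_of_nonneg_left ?_ hB0
    rw [← Finset.sum_add_distrib]
    refine Finset.sum_le_sum fun x _ => ?_
    rw [← Finset.sum_add_distrib]
    refine Finset.sum_le_sum fun y _ => ?_
    have hsum : ind (H ∩ A) x + ind Hᶜ x ≤ 1 := by
      by_cases hx : x ∈ H ∩ A
      · rw [ind_of_mem hx, ind_of_not_mem (fun h => (Set.mem_compl_iff H x).mp h hx.1), add_zero]
      · rw [ind_of_not_mem hx, zero_add]; exact ind_le_one' _ _
    have hnn : 0 ≤ ind (H ∩ A) y * π x y := mul_nonneg (ind_nonneg _ _) (hπ0 x y)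
    nlinarith [hsum, hnn]
  -- bookkeeping: complements
  have hHc : μ.real Hᶜ = 1 - μ.real H := by
    rw [measureReal_compl MeasurableSet.of_discrete, probReal_univ]
  have hAHc : μ.real (A ∩ Hᶜ) = μ.real A - μ.real (H ∩ A) := by
    have := measureReal_inter_add_sdiff (μ := μ) (s := A) (t := H) MeasurableSet.of_discrete
    rw [Set.inter_comm] at this
    rw [show A ∩ Hᶜ = A \ H from rfl]; linarith
  have hHcB : μ.real (Hᶜ ∩ B) = μ.real B - μ.real (H ∩ B) := by
    have := measureReal_inter_add_sdiff (μ := μ) (s := B) (t := H) MeasurableSet.of_discrete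
    rw [Set.inter_comm] at this
    rw [show Hᶜ ∩ B = B \ H from by ext ω; simp only [Set.mem_inter_iff, Set.mem_compl_iff, Set.mem_sdiff]; tauto]
    linarith
  have hB0 : 0 ≤ μ.real B := measureReal_nonneg
  have hL0 : 0 ≤ μ.real Hᶜ := measureReal_nonneg
  -- multiply the hypothesis by `μ(B)` and the staying inequality by `μ(Hᶜ)`
  have h2 : μ.real (A ∩ Hᶜ) * (μ.real B * τH) ≤ μ.real Hᶜ * (μ.real B * τA) := by
    have := mul_le_mul_of_nonneg_left hτ hB0
    nlinarith [this]
  have h1 : μ.real Hᶜ * (μ.real B * (μ.real (H ∩ A) + τA)) ≤ μ.real Hᶜ * μ.real (H ∩ A ∩ B) :=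
    mul_le_mul_of_nonneg_left hτA_le hL0
  rw [osN_ind_ind]
  rw [hτH_eq] at h2
  rw [hAHc, hHcB, hHc] at h2
  rw [hHc] at h1
  nlinarith [h1, h2]

omit [DecidableEq ι] in
/-- **`(S2)` ⟹ `(2′)` for all partners.**  If one upward transport plan `π` from `μ` to `μ(· ∣ B)` has a transition measure whose
normalisation dominates `μ(· ∣ Hᶜ)` on every up-set, then `0 ≤ n(H; 1_A, 1_B)` for EVERY up-set `A`. [this work] -/
theorem osN_ind_ind_nonneg_of_transitionCoupling_all (p : ι → unitInterval) {H B : Set (Set ι)} (hH : IsUpperSet H)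
    (π : Set ι → Set ι → ℝ) (hπ0 : ∀ x y, 0 ≤ π x y) (hπle : ∀ x y, π x y ≠ 0 → x ⊆ y)
    (hrow : ∀ x, ∑ y, π x y = bernoulliWeight p x)
    (hcol : ∀ y, (prodBernoulli p).real B * ∑ x, π x y = bernoulliWeight p y * ind B y)
    (hdom : ∀ A : Set (Set ι), IsUpperSet A →
      (prodBernoulli p).real (A ∩ Hᶜ) * ∑ x, ∑ y, ind Hᶜ x * ind H y * π x y
        ≤ (prodBernoulli p).real Hᶜ * ∑ x, ∑ y, ind Hᶜ x * ind (H ∩ A) y * π x y)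
    {A : Set (Set ι)} (hA : IsUpperSet A) :
    0 ≤ osN p H (ind A) (ind B) :=
  osN_ind_ind_nonneg_of_transitionCoupling p hH hA π hπ0 hπle hrow hcol (hdom A hA)

end SahiOneStep

end Summit.CriticalPhenomena.PercolationContinuityZ3.Theorems
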